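import Summits.NavierStokesRegularity.NavierStokesRegularity.Theorems.TypeICertificateLadderRungReynoldsOneWeightedSlice
import Summits.NavierStokesRegularity.NavierStokesRegularity.Theorems.TypeICertificateLadderRungReynoldsOneWeightedBalance
import Summits.NavierStokesRegularity.NavierStokesRegularity.Theorems.TypeICertificateLadderRungReynoldsOneWeightedSlab
import Summits.NavierStokesRegularity.NavierStokesRegularity.Theorems.TypeICertificateLadderRungReynoldsOneLambSlab
import Summits.NavierStokesRegularity.NavierStokesRegularity.Theorems.TypeICertificateLadderRungReynoldsOneTaoCover
import Summits.NavierStokesRegularity.NavierStokesRegularity.Theorems.TypeICertificateLadderRungReynoldsOneH1Rate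
import Summits.NavierStokesRegularity.NavierStokesRegularity.Theorems.TypeICertificateLadderRungReynoldsOneBookkeepingGlue
import HarnessLib

/-!
# Route TypeICertificateLadder — `RungReynoldsOne` (crux stmt-NavierStokesRegularity-2882): rung `X_1`

RUNG ONE of the Type-I certificate ladder: a classical solution of the unforced Navier–Stokes
system on `ℝ³ × [0, T)` which is Leray–Hopf from its rapidly decaying datum and whose collapse
Reynolds number is eventually at most one, `√(T−t)‖u(t,x)‖ ≤ √ν` for all `x` and all `t < T`
near `T`, extends smoothly past `T`.

The statement is the item's Prop **verbatim**; this module imports NO route (`Theses`) file (so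
that the gate's `_holds` link can import it into the route file without a cycle).

## Proof — line `lp-vorticity-young-budget` (crux idea card `ideas-2882-ideator3` card 1; lead
skeleton `Cruxes/RungReynoldsOne/Lines/lp_vorticity_young_budget.lean`)

With the smooth convex weight `F(y) = (|y|²+1)^{5/4} − 1 ≥ |y|^{5/2}` of the vorticity
`ω = curl u`, the vorticity equation gives the `q = 5/2` member of the `L^q`-vorticity Young budget
`d/dt∫F(ω) ≤ (15/(16ν))‖u‖²_∞∫F(ω)` (stretching integrated by parts onto `u`, both pieces absorbed
by Young into the two viscous pieces: stubs `stub_weightedVorticitySlice`,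
`stub_weightedVorticityBalance`, `stub_weightedVorticitySlab`), hence under the rung hypothesis
`‖u(t)‖²_∞ ≤ ν/(T−t)` the SUBCRITICAL bound `∫F(ω(t)) ≲ (T−t)^{-15/16}`, together with the sharp
`q = 2` bound `∫|∇u(t)|² ≲ (T−t)^{-1/2}` (`Target.Negative.lintegral_frobeniusNormSq_le_exp_half_linfty`)
and `|u|² ≲ 1/(T−t)` (`stub_aprioriDecayOf`, on the Tao-class sub-slabs of `stub_taoCover`). The
enstrophy balance in multiplier form with the Lamb decomposition `(u·∇)u = ω×u + ∇|u|²/2`,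
`d/dt‖∇u‖² ≤ (2ν)⁻¹‖u‖²_{L^{10}}‖ω‖²_{L^{5/2}}` (`stub_enstrophyLambSlab`), with
`∫|u|^{10} ≤ ‖u‖⁴_∞∫|u|⁶`, Sobolev and `∫|ω|^{5/2} ≤ ∫F(ω)`, then integrates to
`‖u(t)‖₂² + ‖∇u(t)‖₂² ≲ (T−t)^{-9/20}` (`stub_enstrophyDecayOf`); but at a singular time Tao's `H¹`
lifespan forces `(‖u(t)‖₂² + ‖∇u(t)‖₂²)²(T−t) ≥ cν³` (`stub_h1BlowupRate`). Since `9/20 < 1/2`,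
the solution extends (`rungReynoldsOne_of_decay_of_rate`). Every analytic input is a theorem of
the tree (`tao2011_smooth_local_existence_holds`, `tao2011_hasBoundedSobolevNormsOn_holds`,
`IsSmoothSpaceTimeOn.enstrophy_balance`, `lintegral_gronwall_le`, `eLpNorm_six_le_eLpNorm_fderiv_two`,
`IsClassicalNSSolutionOn.curl_timeDerivWithin_eq`, …); the proof is unconditional.

References: Leray 1934 §§19–20; Lemarié-Rieusset 2016 Thm. 11.2; Robinson–Rodrigo–Sadowski 2016
Lemma 6.11 / Thm. 8.17; Tao 2013 Thm. 5.4, Cor. 11.1.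
-/

noncomputable section

open Set Filter MeasureTheory
open _root_.Topology
open scoped RealInnerProductSpace ENNReal NNReal Laplacian ContDiff
open Literature.Analysis.FluidPDE

namespace Summit.NavierStokesRegularity.NavierStokesRegularity.Theorems

-- the problem directory `NavierStokesRegularity/NavierStokesRegularity` forces the duplicated namespace
set_option linter.dupNamespace false

open Summit.NavierStokesRegularity.NavierStokesRegularity.Theorems.RungReynoldsOne

/-- Exponent arithmetic: `(K x^{-γ})² · x = K² x^{1 − 2γ}` for `x > 0`. -/
theorem rungReynoldsOne_sq_mul_rpow_neg_mul {x : ℝ} (hx : 0 < x) (K γ : ℝ) :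
    (K * x ^ (-γ)) ^ 2 * x = K ^ 2 * x ^ (1 - 2 * γ) := by
  have h1 : (x ^ (-γ)) ^ 2 = x ^ (-γ * 2) := by
    rw [← Real.rpow_two, ← Real.rpow_mul hx.le]
  have h2 : x ^ (-γ * 2) * x = x ^ (1 - 2 * γ) := by
    conv_lhs => rw [← Real.rpow_one x, ← Real.rpow_mul hx.le, ← Real.rpow_add hx]
    congr 1
    ring
  rw [mul_pow, h1, mul_assoc, h2]

/-- `K² (T − t)^{1−2γ} → 0` as `t ↑ T` when `γ < 1/2`. -/
theorem rungReynoldsOne_tendsto_sq_mul_rpow_sub {T K γ : ℝ} (hγ : γ < 1 / 2) :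
    Tendsto (fun t : ℝ => K ^ 2 * (T - t) ^ (1 - 2 * γ)) (𝓝[<] T) (𝓝 0) := by
  have hpos : 0 < 1 - 2 * γ := by linarith
  have h1 : Tendsto (fun t : ℝ => T - t) (𝓝[<] T) (𝓝 0) := by
    have h : Tendsto (fun t : ℝ => T - t) (𝓝 T) (𝓝 (T - T)) :=
      tendsto_const_nhds.sub tendsto_id
    rw [sub_self] at h
    exact h.mono_left nhdsWithin_le_nhds
  have h2 : Tendsto (fun t : ℝ => (T - t) ^ (1 - 2 * γ)) (𝓝[<] T) (𝓝 0) := by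
    have h := h1.rpow_const (p := 1 - 2 * γ) (Or.inr hpos.le)
    rwa [Real.zero_rpow hpos.ne'] at h
  simpa using h2.const_mul (K ^ 2)

/-- **Subcritical enstrophy growth plus the `H¹` blow-up rate close rung one.** If along every
rate-one solution `‖u(t)‖₂² + ‖∇u(t)‖₂² ≤ K(T−t)^{-9/20}` near `T` and a singular time forces
`cν³ ≤ (‖u(t)‖₂²+‖∇u(t)‖₂²)²(T−t)`, then every rate-one solution extends: otherwise
`cν³ ≤ K²(T−t)^{1/10} → 0`. -/
theorem rungReynoldsOne_of_decay_of_rate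
    (hdecay : ∀ ⦃ν T : ℝ⦄, 0 < ν → 0 < T →
      ∀ ⦃u : ℝ → EuclideanSpace ℝ (Fin 3) → EuclideanSpace ℝ (Fin 3)⦄
        ⦃p : ℝ → EuclideanSpace ℝ (Fin 3) → ℝ⦄,
        IsClassicalNSSolutionOn (Ico 0 T) ν 0 u p → IsLerayHopfOn T ν 0 (u 0) u →
        HasRapidSpatialDecay (u 0) →
        (∀ᶠ t in 𝓝[<] T, ∀ x, Real.sqrt (T - t) * ‖u t x‖ ≤ Real.sqrt ν) →
        ∃ K : ℝ, ∃ t₀ ∈ Ico 0 T, ∀ t ∈ Ico t₀ T,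
          (∫⁻ x, ‖u t x‖ₑ ^ 2) + ∫⁻ x, ENNReal.ofReal (frobeniusNormSq (fderiv ℝ (u t) x)) ≤
            ENNReal.ofReal (K * (T - t) ^ (-(9 / 20 : ℝ))))
    (hrate : ∃ c : ℝ, 0 < c ∧ ∀ ⦃ν T : ℝ⦄, 0 < ν → 0 < T →
      ∀ ⦃u : ℝ → EuclideanSpace ℝ (Fin 3) → EuclideanSpace ℝ (Fin 3)⦄
        ⦃p : ℝ → EuclideanSpace ℝ (Fin 3) → ℝ⦄,
        IsClassicalNSSolutionOn (Ico 0 T) ν 0 u p → IsLerayHopfOn T ν 0 (u 0) u →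
        HasRapidSpatialDecay (u 0) → ¬ HasSmoothExtensionPast ν 0 u T →
      ∀ t ∈ Ico 0 T,
        ENNReal.ofReal (c * ν ^ 3) ≤
          ((∫⁻ x, ‖u t x‖ₑ ^ 2) + ∫⁻ x, ENNReal.ofReal (frobeniusNormSq (fderiv ℝ (u t) x))) ^ 2 *
            ENNReal.ofReal (T - t)) :
    ∀ (ν T : ℝ), 0 < ν → 0 < T →
      ∀ (u : ℝ → EuclideanSpace ℝ (Fin 3) → EuclideanSpace ℝ (Fin 3))
        (p : ℝ → EuclideanSpace ℝ (Fin 3) → ℝ),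
      Literature.Analysis.FluidPDE.IsClassicalNSSolutionOn (Set.Ico 0 T) ν 0 u p →
      Literature.Analysis.FluidPDE.IsLerayHopfOn T ν 0 (u 0) u →
      Literature.Analysis.FluidPDE.HasRapidSpatialDecay (u 0) →
      (∀ᶠ t in 𝓝[<] T, ∀ x, Real.sqrt (T - t) * ‖u t x‖ ≤ Real.sqrt ν) →
      Literature.Analysis.FluidPDE.HasSmoothExtensionPast ν 0 u T := by
  intro ν T hν hT u p hcl hLH hdec hrate1
  by_contra hext
  obtain ⟨K, t₀, ht₀, hK⟩ := hdecay hν hT hcl hLH hdec hrate1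
  obtain ⟨c, hc, hlow⟩ := hrate
  have hlow' := hlow hν hT hcl hLH hdec hext
  have hcν : 0 < c * ν ^ 3 := mul_pos hc (pow_pos hν 3)
  have hγ : (9 / 20 : ℝ) < 1 / 2 := by norm_num
  have hsmall : ∀ᶠ t in 𝓝[<] T, K ^ 2 * (T - t) ^ (1 - 2 * (9 / 20 : ℝ)) < c * ν ^ 3 :=
    (tendsto_order.1 (rungReynoldsOne_tendsto_sq_mul_rpow_sub (T := T) (K := K) hγ)).2 _ hcν
  have hIco : ∀ᶠ t in 𝓝[<] T, t ∈ Ico t₀ T := Ico_mem_nhdsLT ht₀.2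
  obtain ⟨t, ht, hsmallt⟩ := (hIco.and hsmall).exists
  have htT : t ∈ Ico 0 T := ⟨ht₀.1.trans ht.1, ht.2⟩
  have hTt : 0 < T - t := sub_pos.2 ht.2
  have hup := hK t ht
  have hlo := hlow' t htT
  have hnn : 0 ≤ max K 0 * (T - t) ^ (-(9 / 20 : ℝ)) :=
    mul_nonneg (le_max_right _ _) (Real.rpow_nonneg hTt.le _)
  have hup' : (∫⁻ x, ‖u t x‖ₑ ^ 2) + ∫⁻ x, ENNReal.ofReal (frobeniusNormSq (fderiv ℝ (u t) x)) ≤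
      ENNReal.ofReal (max K 0 * (T - t) ^ (-(9 / 20 : ℝ))) := by
    refine hup.trans (ENNReal.ofReal_le_ofReal ?_)
    exact mul_le_mul_of_nonneg_right (le_max_left _ _) (Real.rpow_nonneg hTt.le _)
  have hchain : ENNReal.ofReal (c * ν ^ 3) ≤
      ENNReal.ofReal ((max K 0) ^ 2 * (T - t) ^ (1 - 2 * (9 / 20 : ℝ))) := by
    calc ENNReal.ofReal (c * ν ^ 3)
        ≤ ((∫⁻ x, ‖u t x‖ₑ ^ 2) + ∫⁻ x, ENNReal.ofReal (frobeniusNormSq (fderiv ℝ (u t) x))) ^ 2 *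
            ENNReal.ofReal (T - t) := hlo
      _ ≤ (ENNReal.ofReal (max K 0 * (T - t) ^ (-(9 / 20 : ℝ)))) ^ 2 * ENNReal.ofReal (T - t) := by
          gcongr
      _ = ENNReal.ofReal ((max K 0 * (T - t) ^ (-(9 / 20 : ℝ))) ^ 2 * (T - t)) := by
          rw [ENNReal.ofReal_mul (sq_nonneg _), ENNReal.ofReal_pow hnn]
      _ = ENNReal.ofReal ((max K 0) ^ 2 * (T - t) ^ (1 - 2 * (9 / 20 : ℝ))) := by
          rw [rungReynoldsOne_sq_mul_rpow_neg_mul hTt]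
  have hnn' : 0 ≤ (max K 0) ^ 2 * (T - t) ^ (1 - 2 * (9 / 20 : ℝ)) :=
    mul_nonneg (sq_nonneg _) (Real.rpow_nonneg hTt.le _)
  have h1 := (ENNReal.ofReal_le_ofReal_iff hnn').1 hchain
  have h2 : (max K 0) ^ 2 ≤ K ^ 2 := by
    rcases le_total K 0 with hK0 | hK0
    · rw [max_eq_right hK0]; simpa using sq_nonneg K
    · rw [max_eq_left hK0]
  have h3 : (max K 0) ^ 2 * (T - t) ^ (1 - 2 * (9 / 20 : ℝ)) ≤
      K ^ 2 * (T - t) ^ (1 - 2 * (9 / 20 : ℝ)) :=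
    mul_le_mul_of_nonneg_right h2 (Real.rpow_nonneg hTt.le _)
  linarith

/-- **Rung one of the Type-I certificate ladder** (crux item stmt-NavierStokesRegularity-2882,
verbatim): every classical solution of the unforced Navier–Stokes system on `ℝ³ × [0, T)`
(`ν, T > 0`) which is Leray–Hopf on `[0, T]` from its rapidly decaying datum and whose collapse
Reynolds number is eventually at most one, `√(T - t) ‖u(t, x)‖ ≤ √ν` (all `x`, all `t < T` near
`T`), extends smoothly past `T`. Composition of the line's eight landed stubs through
`rungReynoldsOne_of_decay_of_rate`. -/
theorem typeICertificateLadder_rungReynoldsOne :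
    ∀ (ν T : ℝ), 0 < ν → 0 < T → ∀ (u : ℝ → EuclideanSpace ℝ (Fin 3) → EuclideanSpace ℝ (Fin 3)) (p : ℝ → EuclideanSpace ℝ (Fin 3) → ℝ), Literature.Analysis.FluidPDE.IsClassicalNSSolutionOn (Set.Ico 0 T) ν 0 u p → Literature.Analysis.FluidPDE.IsLerayHopfOn T ν 0 (u 0) u → Literature.Analysis.FluidPDE.HasRapidSpatialDecay (u 0) → (∀ᶠ t in 𝓝[<] T, ∀ x, Real.sqrt (T - t) * ‖u t x‖ ≤ Real.sqrt ν) → Literature.Analysis.FluidPDE.HasSmoothExtensionPast ν 0 u T :=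
  rungReynoldsOne_of_decay_of_rate
    (stub_rateBookkeeping
      (stub_weightedVorticitySlab stub_weightedVorticitySlice stub_weightedVorticityBalance)
      stub_enstrophyLambSlab stub_taoCover)
    stub_h1BlowupRate

end Summit.NavierStokesRegularity.NavierStokesRegularity.Theorems

end
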